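import Mathlib.Analysis.Matrix.Normed
import Mathlib.Topology.Algebra.Module.FiniteDimension
import Literature.Analysis.ODE.LinearGrowth
import Literature.MathematicalPhysics.QuantumFieldTheory.QCDOS
import HarnessLib

/-!
# Lüscher's fermion ("quark") flow on the lattice and flowed quark bilinears

Topic `Literature/MathematicalPhysics/QuantumFieldTheory` (definition request `defn-fermionFlow`,
wanted by route `GradientFlowSpecies` of `QuantumFields/QCD`). Source: M. Lüscher, *Chiral symmetry
and the Yang–Mills gradient flow*, JHEP 04 (2013) 123, arXiv:1302.5246 [Luscher2013], §2 (flow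
equations (2.4)–(2.6), densities (2.8)), §3.3 (fundamental solution (3.13)–(3.14), Wick
contractions (3.9)–(3.12)), §4.1 ((4.5) axial current and density, (4.8) chiral Ward identity at
positive flow time), §5.1 (lattice flow: the Laplacian `Δ = ∇*_μ ∇_μ` of (5.3) built from the
flowed links `V_t`, global existence and uniqueness of the quark flow since `Δ` is bounded and
depends continuously on `t`), §7.1 ((7.1) pseudo-scalar two-point function with a flowed probe),
§8.1 ((8.2) the symmetric lattice divergence `∂̊_μ A_μ`), App. A ((A.4)–(A.6) covariant
difference operators).

## Informal content

At fixed gauge field the quark flow `∂_t χ = Δ[V_t] χ`, `χ|_{t=0} = ψ`, `∂_t χ̄ = χ̄ Δ⃖[V_t]`,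
`χ̄|_{t=0} = ψ̄` (Lüscher (2.4)–(2.6) with the lattice Laplacian (5.3)) is LINEAR in the quark
field, so at the Grassmann level it is a `U`-dependent matrix: `χ_t = K_t(U) ψ` and (footnote † of
§2.1: `η† Δ⃖ := (Δ η)†`) `χ̄_t = ψ̄ K_t(U)ᴴ`, where `K_t(U)` is the fundamental solution of
`dK/dt = Δ[V_t] K`, `K_0 = 1` on site × colour space (flavour-blind, unit matrix in spin; Lüscher
§3.3 after (3.14)), `V_t = B t U` the gradient ("Wilson") flow of the links.

## Contents (everything stated is proved; no named facts)

* Linear ODEs in a complete normed algebra: `linearODEFundamental A` — the fundamental solution of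
  `Φ' = A(t) Φ`, `Φ(0) = 1` for continuous `A : ℝ → 𝔸` (global existence from the tree's
  `Literature.Analysis.ODE.exists_solution_of_linearGrowth`, uniqueness from Mathlib's Grönwall
  `ODE_solution_unique_of_mem_Icc_right`): `linearODEFundamental_zero`,
  `hasDerivAt_linearODEFundamental`, `linearODE_eqOn_Ici` (uniqueness for arbitrary initial data).
* `covariantLaplacian ρ V` — Lüscher's `Δ[V] = Σ_μ ∇*_μ ∇_μ` ((5.3), (A.4)–(A.5)) as a matrix on
  `TorusSite d L × Fin N`, for any gauge group `G` and matrix representation `ρ`; continuity in `V`.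
* `fermionFlowKernel ρ B U t` — `K_t(U)` for a flow map `B : ℝ → GaugeConfig d L G → GaugeConfig d L G`
  (meant: `B = wilsonFlow`, request `defn-wilsonFlow`; any `B` with `t ↦ B t U` continuous on
  `[0, ∞)` will do): the flow equation `hasDerivAt_fermionFlowKernel`, `fermionFlowKernel_zero`,
  uniqueness `eqOn_fermionFlowKernel`, and the semigroup law `fermionFlowKernel_add` under the
  semigroup property of `B`; `fermionFlow ρ B U t χ₀ = K_t(U) χ₀`, the flowed c-number quark field,
  solves Lüscher's quark flow equation (`hasDerivAt_fermionFlow`).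
* QCD (`d = 4`, `SU(3)`, fundamental representation, the Grassmann algebra `FermiAlg N_f L` of
  `QCDOS.lean`): flowed quark / antiquark fields `flowedQuark`, `flowedAntiquark` (even in `U`,
  odd Grassmann), the flowed local bilinears `flowedBilinear Γ` and Lüscher's densities
  `flowedScalarDensity = S^{rs}_t`, `flowedPseudoscalarDensity = P^{rs}_t` ((2.8)); at `t = 0`
  they are the unflowed bilinears (`flowedBilinear_zero`). Unflowed `quarkBilinear Γ`,
  `axialCurrent = A^{rs}_μ`, `pseudoscalarDensity = P^{rs}` ((4.5)), the symmetric lattice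
  divergence `latticeDivergence` ((A.6), (8.2)), and the PCAC quark-mass estimator with flowed
  pseudo-scalar probe `flowedPCACMass` (expectations through `qcdTorusExpect`).

## Design choices

* The kernel is parametrised by an abstract link flow `B` rather than importing `wilsonFlow`
  (not yet in the tree): `fermionFlowKernel ρ wilsonFlow U t` is then Lüscher's `K(t, ·; 0, ·)`.
  The two-time kernel `K(t, x; s, y)` of (3.13) is `K_{t-s}(B s U)` when `B` is a semigroup
  (`fermionFlowKernel_add`).
* Flow time is `t ≥ 0` (Lüscher §2.1). To get honest two-sided derivatives at `t = 0` without
  assuming anything about `B` at negative times, the kernel solves `K' = Δ[B (max t 0) U] K` on all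
  of `ℝ` (for `t < 0`: the heat flow in the frozen background `B 0 U`, a harmless smooth junk
  extension); all statements are about `t ≥ 0`.
* Matrix-valued derivatives are taken in the `L∞`-operator norm (`Matrix.Norms.Operator`, a
  definitional choice invisible in the statements, which are entrywise `HasDerivAt`s).
* `P^{rs}_t = χ̄_r γ₅ χ_s` carries NO factor `i` (Lüscher (2.8), (4.5)), unlike `QCDOS`'s hermitian
  convention `pseudoscalarBilinear = ψ̄ iγ₅ ψ` (`pseudoscalarBilinear_eq_quarkBilinear`).
* `flowedPCACMass` is the plain ratio `⟨∂̊_μ A^{rs}_μ(x) P^{sr}_t(y)⟩ / (2 ⟨P^{rs}(x) P^{sr}_t(y)⟩)`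
  asked for by the route; by Lüscher's Ward identity (4.8) the flowed probe brings in the extra
  term `P̃^{rs}` built from Lagrange-multiplier fields, whose contribution is governed by the
  kernel `K(t, y; 0, x)` (Gaussian-like decay in `|x - y|`, §4.3) — it is NOT dropped by any
  theorem here; only the estimator is defined. O(`a`) improvement terms (§6, §8) are not encoded.
* Not here: the gauge flow itself (`defn-wilsonFlow`), gauge covariance `K_t(U^g) = g K_t(U) g⁻¹`
  (needs covariance of `B`; the Laplacian's covariance is routine but lengthy), `ℓ²`-contractivity
  of `K_t`, renormalisation statements (`Z_χ`, (4.11)–(4.16)) — those are facts about the continuum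
  limit, not definitions.
-/

noncomputable section

open Set Metric Filter Topology Matrix
open scoped NNReal
open Literature.Probability.LatticeModels Literature.MathematicalPhysics.QuantumLattice

namespace Literature.MathematicalPhysics.QuantumFieldTheory

/-! ## Linear ordinary differential equations `Φ' = A(t) Φ` in a normed algebra -/

section LinearODE

variable {𝔸 : Type*} [NormedRing 𝔸]

/-- A continuous coefficient is bounded on compact time intervals (by a nonnegative real). [folklore] -/
theorem exists_nnreal_bound_of_continuousOn {A : ℝ → 𝔸} {a b : ℝ} (hA : ContinuousOn A (Icc a b)) :
    ∃ M : ℝ≥0, ∀ t ∈ Icc a b, ‖A t‖ ≤ M := by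
  obtain ⟨C, hC⟩ := isCompact_Icc.exists_bound_of_continuousOn hA
  exact ⟨⟨max C 0, le_max_right _ _⟩, fun t ht => (hC t ht).trans (le_max_left _ _)⟩

/-- Left multiplication by `A` is `‖A‖`-Lipschitz in a normed ring. [folklore] -/
theorem lipschitzWith_mul_left_of_norm_le {A : 𝔸} {M : ℝ≥0} (hM : ‖A‖ ≤ M) :
    LipschitzWith M (fun x : 𝔸 => A * x) :=
  LipschitzWith.of_dist_le_mul fun x y => by
    rw [dist_eq_norm, dist_eq_norm, ← mul_sub]
    exact (norm_mul_le _ _).trans (mul_le_mul_of_nonneg_right hM (norm_nonneg _))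

variable [NormedAlgebra ℝ 𝔸]

/-- **Uniqueness for linear equations on `[0, ∞)`**: two solutions of `Φ' = A(t) Φ` (derivatives
within `[0, ∞)`, i.e. a right derivative at `0`) with continuous `A` and the same initial value
coincide on `[0, ∞)` (Grönwall; Hartman, Ch. IV, Lemma 1.1; Mathlib
`ODE_solution_unique_of_mem_Icc_right` on every `[0, T]` with the Lipschitz constant
`sup_{[0,T]} ‖A‖`). [cite: Hartman2002, Ch. IV Lemma 1.1] -/
theorem linearODE_eqOn_Ici {A : ℝ → 𝔸} (hA : ContinuousOn A (Ici 0)) {Φ Ψ : ℝ → 𝔸}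
    (hΦ : ∀ t, 0 ≤ t → HasDerivWithinAt Φ (A t * Φ t) (Ici 0) t)
    (hΨ : ∀ t, 0 ≤ t → HasDerivWithinAt Ψ (A t * Ψ t) (Ici 0) t) (h0 : Φ 0 = Ψ 0) :
    EqOn Φ Ψ (Ici 0) := by
  intro t ht
  have ht' : t ∈ Icc 0 (t + 1) := ⟨ht, by linarith⟩
  obtain ⟨M, hM⟩ :=
    exists_nnreal_bound_of_continuousOn (hA.mono (Icc_subset_Ici_self : Icc 0 (t + 1) ⊆ Ici 0))
  exact ODE_solution_unique_of_mem_Icc_right (v := fun s x => A s * x) (s := fun _ => univ)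
    (K := M)
    (fun s hs => (lipschitzWith_mul_left_of_norm_le (hM s (Ico_subset_Icc_self hs))).lipschitzOnWith)
    (fun s hs => ((hΦ s hs.1).continuousWithinAt).mono Icc_subset_Ici_self)
    (fun s hs => (hΦ s hs.1).mono (Ici_subset_Ici.2 hs.1)) (fun _ _ => trivial)
    (fun s hs => ((hΨ s hs.1).continuousWithinAt).mono Icc_subset_Ici_self)
    (fun s hs => (hΨ s hs.1).mono (Ici_subset_Ici.2 hs.1)) (fun _ _ => trivial) h0 ht'

variable [CompleteSpace 𝔸]

/-- **Global existence for linear equations**: for continuous `A : ℝ → 𝔸` (complete normed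
algebra) and every `X`, the equation `Φ' = A(t) Φ` has a solution on all of `ℝ` with `Φ 0 = X`
(the field `x ↦ A(t) x` is `‖A(t)‖`-Lipschitz of linear growth; Hartman, Ch. IV, Lemma 1.1, via the
tree's `Literature.Analysis.ODE.exists_solution_of_linearGrowth`). [cite: Hartman2002, Ch. IV Lemma 1.1] -/
theorem exists_linearODE_solution {A : ℝ → 𝔸} (hA : Continuous A) (X : 𝔸) :
    ∃ Φ : ℝ → 𝔸, Φ 0 = X ∧ ∀ t, HasDerivAt Φ (A t * Φ t) t := by
  refine Literature.Analysis.ODE.exists_solution_of_linearGrowth (v := fun t x => A t * x)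
    (fun T => ?_) (fun x => hA.mul continuous_const) X
  obtain ⟨M, hM⟩ := exists_nnreal_bound_of_continuousOn (hA.continuousOn (s := Icc (-T) T))
  exact ⟨M, fun t ht => ⟨lipschitzWith_mul_left_of_norm_le (hM t ht), fun x =>
    (norm_mul_le _ _).trans (mul_le_mul_of_nonneg_right (hM t ht) (norm_nonneg _))⟩⟩

/-- **The fundamental solution** `Φ_A : ℝ → 𝔸` of the linear equation `Φ' = A(t) Φ`,
`Φ(0) = 1`, in a complete normed algebra (a global solution chosen by `Classical.choice`; it
exists for continuous `A`, `exists_linearODE_solution`, and is then unique, `linearODE_eqOn_Ici`;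
junk value the constant `1` when no global solution exists) (Hartman, Ch. IV §1, fundamental
matrices). [cite: Hartman2002, Ch. IV §1] -/
def linearODEFundamental (A : ℝ → 𝔸) : ℝ → 𝔸 := by
  classical
  exact if h : ∃ Φ : ℝ → 𝔸, Φ 0 = 1 ∧ ∀ t, HasDerivAt Φ (A t * Φ t) t then h.choose else 1

/-- The fundamental solution starts at `1` (for continuous `A`). [folklore] -/
theorem linearODEFundamental_zero {A : ℝ → 𝔸} (hA : Continuous A) :
    linearODEFundamental A 0 = 1 := by
  classical
  have h := exists_linearODE_solution hA 1
  simp only [linearODEFundamental, dif_pos h]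
  exact h.choose_spec.1

/-- The fundamental solution solves `Φ' = A(t) Φ` at every time (for continuous `A`). [folklore] -/
theorem hasDerivAt_linearODEFundamental {A : ℝ → 𝔸} (hA : Continuous A) (t : ℝ) :
    HasDerivAt (linearODEFundamental A) (A t * linearODEFundamental A t) t := by
  classical
  have h := exists_linearODE_solution hA 1
  simp only [linearODEFundamental, dif_pos h]
  exact h.choose_spec.2 t

/-- Right translates `Φ_A(t) X` solve the same equation (from `X`). [folklore] -/
theorem hasDerivAt_linearODEFundamental_mul {A : ℝ → 𝔸} (hA : Continuous A) (X : 𝔸) (t : ℝ) :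
    HasDerivAt (fun s => linearODEFundamental A s * X) (A t * (linearODEFundamental A t * X)) t := by
  simpa only [mul_assoc] using (hasDerivAt_linearODEFundamental hA t).mul_const X

/-- The fundamental solution is continuous (for continuous `A`). [folklore] -/
theorem continuous_linearODEFundamental {A : ℝ → 𝔸} (hA : Continuous A) :
    Continuous (linearODEFundamental A) :=
  continuous_iff_continuousAt.2 fun t => (hasDerivAt_linearODEFundamental hA t).continuousAt

end LinearODE

/-! ## Matrix-valued curves: entrywise derivatives (in the `L∞` operator norm) -/

section MatrixCurves

open scoped Matrix.Norms.Operator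

variable {ι : Type*} [Fintype ι]

/-- Entries of a differentiable matrix curve are differentiable, with the entries of the
derivative. [folklore] -/
theorem hasDerivWithinAt_matrix_entry {Φ : ℝ → Matrix ι ι ℂ} {Φ' : Matrix ι ι ℂ} {s : Set ℝ}
    {t : ℝ} (h : HasDerivWithinAt Φ Φ' s t) (i j : ι) :
    HasDerivWithinAt (fun τ => Φ τ i j) (Φ' i j) s t :=
  (LinearMap.toContinuousLinearMap (Matrix.entryLinearMap ℝ ℂ i j)).hasFDerivAt.comp_hasDerivWithinAt
    t h

variable [DecidableEq ι]

/-- A matrix curve is differentiable if all its entries are. [folklore] -/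
theorem hasDerivWithinAt_matrix_of_entry {Φ : ℝ → Matrix ι ι ℂ} {Φ' : Matrix ι ι ℂ} {s : Set ℝ}
    {t : ℝ} (h : ∀ i j, HasDerivWithinAt (fun τ => Φ τ i j) (Φ' i j) s t) :
    HasDerivWithinAt Φ Φ' s t := by
  have hΦ : Φ = fun τ => ∑ i, ∑ j, (Φ τ i j) • Matrix.single i j (1 : ℂ) := by
    funext τ
    conv_lhs => rw [Matrix.matrix_eq_sum_single (Φ τ)]
    simp [Matrix.smul_single]
  have hΦ' : Φ' = ∑ i, ∑ j, (Φ' i j) • Matrix.single i j (1 : ℂ) := by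
    conv_lhs => rw [Matrix.matrix_eq_sum_single Φ']
    simp [Matrix.smul_single]
  rw [hΦ, hΦ']
  exact HasDerivWithinAt.fun_sum fun i _ => HasDerivWithinAt.fun_sum fun j _ =>
    (h i j).smul_const (Matrix.single i j (1 : ℂ))

end MatrixCurves

/-! ## The gauge-covariant lattice Laplacian -/

section Laplacian

variable {d L N : ℕ} {G : Type*} [Group G] (ρ : G →* Matrix (Fin N) (Fin N) ℂ)

/-- **Lüscher's gauge-covariant lattice Laplacian** `Δ[V] = Σ_μ ∇*_μ ∇_μ` in the background `V`,
acting on colour vector fields on the torus (no spin, no flavour, no mass term), as a matrix on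
site × colour: with `∇_μ χ(x) = V(x,μ) χ(x+μ̂) - χ(x)` and `∇*_μ χ(x) = χ(x) - V(x-μ̂,μ)⁻¹ χ(x-μ̂)`,
`(Δ χ)(x) = Σ_μ [V(x,μ) χ(x+μ̂) - 2 χ(x) + V(x-μ̂,μ)⁻¹ χ(x-μ̂)]`, i.e.
`Δ_{(x,a),(y,b)} = Σ_μ (ρ(V(x,μ))_{ab} δ_{y,x+μ̂} + ρ(V(y,μ)⁻¹)_{ab} δ_{x,y+μ̂}) - 2d δ_{xy} δ_{ab}`
(same link orientation as the tree's `wilsonDirac`, whose Wilson term is `-(r/2) Δ ⊗ 1`).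
On tori of side `L ≤ 2` coincident neighbours simply add up. [cite: Luscher2013, (5.3) and (A.4)–(A.5)] -/
def covariantLaplacian (V : GaugeConfig d L G) :
    Matrix (TorusSite d L × Fin N) (TorusSite d L × Fin N) ℂ :=
  Matrix.of fun p q =>
    (∑ μ : Fin d,
      ((if q.1 = QuantumFieldTheory.Site.shift p.1 μ then ρ (V (p.1, μ)) p.2 q.2 else 0) +
        (if p.1 = QuantumFieldTheory.Site.shift q.1 μ then ρ (V (q.1, μ))⁻¹ p.2 q.2 else 0))) -
      (if p = q then (2 * d : ℂ) else 0)

/-- Unfolding the Laplacian entrywise. [folklore] -/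
theorem covariantLaplacian_apply (V : GaugeConfig d L G) (p q : TorusSite d L × Fin N) :
    covariantLaplacian ρ V p q =
      (∑ μ : Fin d,
        ((if q.1 = QuantumFieldTheory.Site.shift p.1 μ then ρ (V (p.1, μ)) p.2 q.2 else 0) +
          (if p.1 = QuantumFieldTheory.Site.shift q.1 μ then ρ (V (q.1, μ))⁻¹ p.2 q.2 else 0))) -
        (if p = q then (2 * d : ℂ) else 0) := rfl

variable [TopologicalSpace G] [IsTopologicalGroup G]

/-- The Laplacian depends continuously on the gauge field (entrywise it is a polynomial in the
entries of `ρ(V_e)` and `ρ(V_e⁻¹)`), for a continuous representation of a topological group.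
[folklore] -/
theorem continuous_covariantLaplacian_apply (hρ : Continuous ρ) (p q : TorusSite d L × Fin N) :
    Continuous fun V : GaugeConfig d L G => covariantLaplacian ρ V p q := by
  simp only [covariantLaplacian_apply]
  refine Continuous.sub (continuous_finsetSum _ fun μ _ => Continuous.add ?_ ?_) continuous_const
  · split_ifs
    · exact ((hρ.comp (continuous_apply _)).matrix_elem _ _)
    · exact continuous_const
  · split_ifs
    · exact ((hρ.comp ((continuous_apply _).inv)).matrix_elem _ _)
    · exact continuous_const

end Laplacian

/-! ## The fermion flow kernel `K_t(U)` -/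

section Kernel

open scoped Matrix.Norms.Operator

variable {d L N : ℕ} [NeZero L] {G : Type*} [Group G] (ρ : G →* Matrix (Fin N) (Fin N) ℂ)

/-- The coefficient path of the quark flow equation in the background `U` flowed by `B`:
`t ↦ Δ[B (max t 0) U]` (frozen at `B 0 U` for negative times, see the module docstring). [folklore] -/
def fermionFlowCoeff (B : ℝ → GaugeConfig d L G → GaugeConfig d L G) (U : GaugeConfig d L G) (t : ℝ) :
    Matrix (TorusSite d L × Fin N) (TorusSite d L × Fin N) ℂ :=
  covariantLaplacian ρ (B (max t 0) U)

/-- **The fermion flow kernel** `K_t(U)`: the fundamental solution of Lüscher's lattice quark flow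
equation `dK_t/dt = Δ[V_t] K_t`, `K_0 = 1`, `V_t = B t U` the flowed gauge field, as a matrix on
site × colour (flavour-blind and trivial in spin: Lüscher §3.3 after (3.14)). With `B` the Wilson
flow this is the kernel `K(t, x; 0, y)` of (3.13)–(3.14) (`α₀ = 0`), through which the flowed quark
fields are `χ_t = K_t ψ`, `χ̄_t = ψ̄ K_tᴴ`. Defined for all real `t` (for `t < 0` it continues with
the frozen background `B 0 U`); meaningful for `t ≥ 0`. [cite: Luscher2013, (2.4)–(2.6), (3.13)–(3.14) and §5.1] -/
def fermionFlowKernel (B : ℝ → GaugeConfig d L G → GaugeConfig d L G) (U : GaugeConfig d L G)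
    (t : ℝ) : Matrix (TorusSite d L × Fin N) (TorusSite d L × Fin N) ℂ :=
  linearODEFundamental (fermionFlowCoeff ρ B U) t

/-- **The fermion flow of a c-number quark field** (one colour vector per site; spin and flavour
are spectators): `χ_t = K_t(U) χ₀`, the solution of Lüscher's quark flow equation
`∂_t χ = Δ[V_t] χ`, `χ|_{t=0} = χ₀` ((2.4)–(2.6) with the lattice Laplacian (5.3)). [cite: Luscher2013, (2.4)–(2.6) and (5.3)] -/
def fermionFlow (B : ℝ → GaugeConfig d L G → GaugeConfig d L G) (U : GaugeConfig d L G) (t : ℝ)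
    (χ₀ : TorusSite d L × Fin N → ℂ) : TorusSite d L × Fin N → ℂ :=
  (fermionFlowKernel ρ B U t).mulVec χ₀

variable {ρ} [TopologicalSpace G] [IsTopologicalGroup G]
variable {B : ℝ → GaugeConfig d L G → GaugeConfig d L G} {U : GaugeConfig d L G}

omit [NeZero L] in
/-- The coefficient path is continuous when `ρ` is continuous and `t ↦ B t U` is continuous on
`[0, ∞)` (product topology). [folklore] -/
theorem continuous_fermionFlowCoeff (hρ : Continuous ρ) (hB : ContinuousOn (fun t => B t U) (Ici 0)) :
    Continuous (fermionFlowCoeff ρ B U) := by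
  have hmax : Continuous fun t : ℝ => B (max t 0) U :=
    hB.comp_continuous (continuous_id.max continuous_const) fun t => Set.mem_Ici.2 (le_max_right t 0)
  exact continuous_matrix fun p q => (continuous_covariantLaplacian_apply ρ hρ p q).comp hmax

omit [NeZero L] [TopologicalSpace G] [IsTopologicalGroup G] in
/-- For `t ≥ 0` the coefficient is the Laplacian of the flowed field `B t U`. [folklore] -/
theorem fermionFlowCoeff_of_nonneg {t : ℝ} (ht : 0 ≤ t) :
    fermionFlowCoeff ρ B U t = covariantLaplacian ρ (B t U) := by
  rw [fermionFlowCoeff, max_eq_left ht]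

/-- **Initial condition** `K_0(U) = 1` (Lüscher (2.6)/(3.14)). [cite: Luscher2013, (2.6) and (3.14)] -/
theorem fermionFlowKernel_zero (hρ : Continuous ρ) (hB : ContinuousOn (fun t => B t U) (Ici 0)) :
    fermionFlowKernel ρ B U 0 = 1 :=
  linearODEFundamental_zero (continuous_fermionFlowCoeff hρ hB)

/-- **The quark flow equation for the kernel**, entrywise: for `t ≥ 0`,
`d/dt K_t(U)_{vw} = (Δ[B t U] K_t(U))_{vw}` (Lüscher (2.4) with (5.3); two-sided derivative, also
at `t = 0`). [cite: Luscher2013, (2.4) and (5.3)] -/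
theorem hasDerivAt_fermionFlowKernel (hρ : Continuous ρ) (hB : ContinuousOn (fun t => B t U) (Ici 0))
    {t : ℝ} (ht : 0 ≤ t) (v w : TorusSite d L × Fin N) :
    HasDerivAt (fun s => fermionFlowKernel ρ B U s v w)
      ((covariantLaplacian ρ (B t U) * fermionFlowKernel ρ B U t) v w) t := by
  have h := (hasDerivAt_linearODEFundamental (continuous_fermionFlowCoeff hρ hB) t).hasDerivWithinAt
    (s := univ)
  rw [fermionFlowCoeff_of_nonneg ht] at h
  exact (hasDerivWithinAt_matrix_entry h v w).hasDerivAt Filter.univ_mem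

/-- The kernel is continuous in the flow time. [folklore] -/
theorem continuous_fermionFlowKernel (hρ : Continuous ρ) (hB : ContinuousOn (fun t => B t U) (Ici 0)) :
    Continuous (fermionFlowKernel ρ B U) :=
  continuous_linearODEFundamental (continuous_fermionFlowCoeff hρ hB)

/-- **Uniqueness of the kernel** (Lüscher §5.1: "global existence, uniqueness and smoothness"):
any matrix curve `M` with `M 0 = K₀` whose entries solve `M' = Δ[B t U] M` on `[0, ∞)` (derivatives
within `[0, ∞)`) agrees there with `t ↦ K_t(U) K₀`; in particular (`K₀ = 1`) with the kernel.
[cite: Luscher2013, §5.1] -/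
theorem eqOn_fermionFlowKernel_mul (hρ : Continuous ρ) (hB : ContinuousOn (fun t => B t U) (Ici 0))
    {M : ℝ → Matrix (TorusSite d L × Fin N) (TorusSite d L × Fin N) ℂ}
    (hM : ∀ t, 0 ≤ t → ∀ v w, HasDerivWithinAt (fun s => M s v w)
      ((covariantLaplacian ρ (B t U) * M t) v w) (Ici 0) t) :
    EqOn M (fun t => fermionFlowKernel ρ B U t * M 0) (Ici 0) := by
  have hA := continuous_fermionFlowCoeff (ρ := ρ) hρ hB
  refine linearODE_eqOn_Ici hA.continuousOn (fun t ht => ?_) (fun t ht => ?_) ?_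
  · rw [fermionFlowCoeff_of_nonneg ht]
    exact hasDerivWithinAt_matrix_of_entry (hM t ht)
  · exact (hasDerivAt_linearODEFundamental_mul hA (M 0) t).hasDerivWithinAt
  · change M 0 = linearODEFundamental (fermionFlowCoeff ρ B U) 0 * M 0
    rw [linearODEFundamental_zero hA, one_mul]

/-- Uniqueness of the kernel among solutions from `1`. [cite: Luscher2013, §5.1] -/
theorem eqOn_fermionFlowKernel (hρ : Continuous ρ) (hB : ContinuousOn (fun t => B t U) (Ici 0))
    {M : ℝ → Matrix (TorusSite d L × Fin N) (TorusSite d L × Fin N) ℂ} (hM0 : M 0 = 1)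
    (hM : ∀ t, 0 ≤ t → ∀ v w, HasDerivWithinAt (fun s => M s v w)
      ((covariantLaplacian ρ (B t U) * M t) v w) (Ici 0) t) :
    EqOn M (fermionFlowKernel ρ B U) (Ici 0) := fun t ht => by
  simpa [hM0] using eqOn_fermionFlowKernel_mul hρ hB hM ht

/-- **Semigroup law / two-time kernel.** If the link flow `B` is a semigroup on `[0, ∞)` and
`t ↦ B t V` is continuous on `[0, ∞)` for every `V`, then `K_{t+s}(U) = K_t(B s U) K_s(U)` for
`s, t ≥ 0`: the kernel from flow time `s` to `s + t` in the background `U` is the kernel from `0`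
to `t` in the background `V_s` (Lüscher (3.13): `K(t, ·; s, ·)`). [cite: Luscher2013, (3.13)–(3.14)] -/
theorem fermionFlowKernel_add (B : ℝ → GaugeConfig d L G → GaugeConfig d L G) (U : GaugeConfig d L G)
    (hρ : Continuous ρ) (hB : ∀ V : GaugeConfig d L G, ContinuousOn (fun t => B t V) (Ici 0))
    (hsemi : ∀ t s : ℝ, 0 ≤ t → 0 ≤ s → ∀ V : GaugeConfig d L G, B t (B s V) = B (t + s) V)
    {s t : ℝ} (hs : 0 ≤ s) (ht : 0 ≤ t) :
    fermionFlowKernel ρ B U (t + s) = fermionFlowKernel ρ B (B s U) t * fermionFlowKernel ρ B U s := by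
  -- `τ ↦ K_{τ+s}(U)` solves the equation in the background `B s U` from `K_s(U)`
  set M : ℝ → Matrix (TorusSite d L × Fin N) (TorusSite d L × Fin N) ℂ :=
    fun τ => fermionFlowKernel ρ B U (τ + s) with hMdef
  have hM : ∀ τ, 0 ≤ τ → ∀ v w, HasDerivWithinAt (fun σ => M σ v w)
      ((covariantLaplacian ρ (B τ (B s U)) * M τ) v w) (Ici 0) τ := by
    intro τ hτ v w
    have h1 := hasDerivAt_fermionFlowKernel (ρ := ρ) hρ (hB U) (t := τ + s) (by linarith) v w
    have h2 : HasDerivAt (fun σ => fermionFlowKernel ρ B U (σ + s) v w)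
        ((covariantLaplacian ρ (B (τ + s) U) * fermionFlowKernel ρ B U (τ + s)) v w) τ := by
      simpa using h1.comp_add_const τ s
    rw [hsemi τ s hτ hs U]
    exact h2.hasDerivWithinAt
  have := eqOn_fermionFlowKernel_mul (ρ := ρ) hρ (hB (B s U)) hM ht
  simpa [hMdef] using this

/-- `χ_0 = χ₀`. [cite: Luscher2013, (2.6)] -/
theorem fermionFlow_zero (hρ : Continuous ρ) (hB : ContinuousOn (fun t => B t U) (Ici 0))
    (χ₀ : TorusSite d L × Fin N → ℂ) : fermionFlow ρ B U 0 χ₀ = χ₀ := by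
  simp [fermionFlow, fermionFlowKernel_zero hρ hB]

/-- **The quark flow equation** `∂_t χ_t(v) = (Δ[V_t] χ_t)(v)` for `t ≥ 0`, componentwise
(Lüscher (2.4), lattice form §5.1). [cite: Luscher2013, (2.4) and §5.1] -/
theorem hasDerivAt_fermionFlow (hρ : Continuous ρ) (hB : ContinuousOn (fun t => B t U) (Ici 0))
    (χ₀ : TorusSite d L × Fin N → ℂ) {t : ℝ} (ht : 0 ≤ t) (v : TorusSite d L × Fin N) :
    HasDerivAt (fun s => fermionFlow ρ B U s χ₀ v)
      ((covariantLaplacian ρ (B t U)).mulVec (fermionFlow ρ B U t χ₀) v) t := by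
  have h : HasDerivAt (fun s => ∑ w, fermionFlowKernel ρ B U s v w * χ₀ w)
      (∑ w, (covariantLaplacian ρ (B t U) * fermionFlowKernel ρ B U t) v w * χ₀ w) t :=
    HasDerivAt.fun_sum fun w _ => (hasDerivAt_fermionFlowKernel hρ hB ht v w).mul_const (χ₀ w)
  have hEq : (∑ w, (covariantLaplacian ρ (B t U) * fermionFlowKernel ρ B U t) v w * χ₀ w) =
      (covariantLaplacian ρ (B t U)).mulVec (fermionFlow ρ B U t χ₀) v := by
    simp only [fermionFlow, Matrix.mulVec_mulVec]
    rfl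
  rw [hEq] at h
  exact h

end Kernel

/-! ## Flowed quark fields and bilinears in lattice QCD (`SU(3)`, `d = 4`) -/

section QCD

variable {Nf L : ℕ} [NeZero L]
  (B : ℝ → GaugeConfig 4 L (Matrix.specialUnitaryGroup (Fin 3) ℂ) → GaugeConfig 4 L (Matrix.specialUnitaryGroup (Fin 3) ℂ))
  (U : GaugeConfig 4 L (Matrix.specialUnitaryGroup (Fin 3) ℂ))

/-- The QCD fermion flow kernel `K_t(U)` for the link flow `B`: `SU(3)`, fundamental
representation, four-torus of side `L`. [cite: Luscher2013, §5.1] -/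
abbrev qcdFlowKernel (t : ℝ) : Matrix (TorusSite 4 L × Fin 3) (TorusSite 4 L × Fin 3) ℂ :=
  fermionFlowKernel (fundamentalRep (Fin 3)) B U t

/-- **The flowed quark field** `χ_{f,t}(x)_{a α} = Σ_{y,b} K_t(U)_{(x,a),(y,b)} ψ_{f,(y,b,α)}` as an
odd element of the quark Grassmann algebra (Lüscher (2.4)–(2.6): `χ_t = K_t ψ`; flavour `f` and
spin `α` are spectators). [cite: Luscher2013, (2.4)–(2.6) and (3.9)–(3.12)] -/
def flowedQuark (t : ℝ) (v : QuarkVar Nf L) : FermiAlg Nf L :=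
  ∑ y : TorusSite 4 L, ∑ b : Fin 3,
    qcdFlowKernel B U t (v.2.1, v.2.2.1) (y, b) • q (v.1, (y, b, v.2.2.2))

/-- **The flowed antiquark field** `χ̄_{f,t}(x)_{a α} = Σ_{y,b} ψ̄_{f,(y,b,α)} conj(K_t(U)_{(x,a),(y,b)})`,
i.e. `χ̄_t = ψ̄ K_tᴴ` (Lüscher (2.4): `∂_t χ̄ = χ̄ Δ⃖` with the left action `η† Δ⃖ = (Δ η)†` of
footnote † in §2.1; cf. the adjoint kernel in (3.11)–(3.12)). [cite: Luscher2013, (2.4)–(2.6) and (3.11)–(3.12)] -/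
def flowedAntiquark (t : ℝ) (v : QuarkVar Nf L) : FermiAlg Nf L :=
  ∑ y : TorusSite 4 L, ∑ b : Fin 3,
    star (qcdFlowKernel B U t (v.2.1, v.2.2.1) (y, b)) • qbar (v.1, (y, b, v.2.2.2))

/-- The local quark bilinear `ψ̄_r(x) Γ ψ_s(x) = Σ_{a,α,β} Γ_{αβ} ψ̄_{r,(x,a,α)} ψ_{s,(x,a,β)}` for a
spin matrix `Γ` (colour-singlet, flavour `r s`). [cite: MontvayMunster1994, §5.1 (meson fields)] -/
def quarkBilinear (Γ : Matrix (Fin 4) (Fin 4) ℂ) (r s : Fin Nf) (x : TorusSite 4 L) : FermiAlg Nf L :=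
  ∑ a : Fin 3, ∑ α : Fin 4, ∑ β : Fin 4, Γ α β • (qbar (r, (x, a, α)) * q (s, (x, a, β)))

/-- **The flowed local bilinear** `χ̄_r(t,x) Γ χ_s(t,x) = Σ_{a,α,β} Γ_{αβ} χ̄_{r,t,(x,a,α)} χ_{s,t,(x,a,β)}`
in the background `U`, an even Grassmann element depending on `U` through `K_t(U)`
(Lüscher (2.8) for `Γ = 1, γ₅`). [cite: Luscher2013, (2.8)] -/
def flowedBilinear (t : ℝ) (Γ : Matrix (Fin 4) (Fin 4) ℂ) (r s : Fin Nf) (x : TorusSite 4 L) :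
    FermiAlg Nf L :=
  ∑ a : Fin 3, ∑ α : Fin 4, ∑ β : Fin 4,
    Γ α β • (flowedAntiquark B U t (r, (x, a, α)) * flowedQuark B U t (s, (x, a, β)))

/-- Lüscher's **flowed scalar density** `S^{rs}_t(x) = χ̄_r(t,x) χ_s(t,x)` (its expectation is minus
the "time-dependent condensate" (2.17)). [cite: Luscher2013, (2.8)] -/
def flowedScalarDensity (t : ℝ) (r s : Fin Nf) (x : TorusSite 4 L) : FermiAlg Nf L :=
  flowedBilinear B U t 1 r s x

/-- Lüscher's **flowed pseudo-scalar density** `P^{rs}_t(x) = χ̄_r(t,x) γ₅ χ_s(t,x)` (no factor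
`i`). [cite: Luscher2013, (2.8)] -/
def flowedPseudoscalarDensity (t : ℝ) (r s : Fin Nf) (x : TorusSite 4 L) : FermiAlg Nf L :=
  flowedBilinear B U t gammaFive r s x

/-- The **axial current** `A^{rs}_μ(x) = ψ̄_r(x) γ_μ γ₅ ψ_s(x)` at flow time zero. [cite: Luscher2013, (4.5)] -/
def axialCurrent (r s : Fin Nf) (μ : Fin 4) (x : TorusSite 4 L) : FermiAlg Nf L :=
  quarkBilinear (euclideanGamma μ * gammaFive) r s x

/-- The **pseudo-scalar density** `P^{rs}(x) = ψ̄_r(x) γ₅ ψ_s(x)` at flow time zero (no factor `i`).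
[cite: Luscher2013, (4.5)] -/
def pseudoscalarDensity (r s : Fin Nf) (x : TorusSite 4 L) : FermiAlg Nf L :=
  quarkBilinear gammaFive r s x

/-- The **symmetric lattice divergence** `∂̊_μ J_μ(x) = ½ Σ_μ (J_μ(x+μ̂) - J_μ(x-μ̂))` of a lattice
vector field of Grassmann elements (`∂̊_μ = ½(∂_μ + ∂*_μ)`, Lüscher (A.6), as used for the axial
current in (8.2)). [cite: Luscher2013, (A.6) and (8.2)] -/
def latticeDivergence (J : Fin 4 → TorusSite 4 L → FermiAlg Nf L) (x : TorusSite 4 L) :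
    FermiAlg Nf L :=
  (1 / 2 : ℂ) • ∑ μ : Fin 4, (J μ (QuantumFieldTheory.Site.shift x μ) - J μ (x - Pi.single μ 1))

/-- `∂̊_μ A^{rs}_μ(x)`, the divergence of the axial current. [cite: Luscher2013, (4.6) and (8.2)] -/
def axialDivergence (r s : Fin Nf) (x : TorusSite 4 L) : FermiAlg Nf L :=
  latticeDivergence (fun μ y => axialCurrent r s μ y) x

variable (L)

/-- **The PCAC quark-mass estimator with a flowed pseudo-scalar probe**
`m_{rs}(t; x, y) = ⟨∂̊_μ A^{rs}_μ(x) P^{sr}_t(y)⟩ / (2 ⟨P^{rs}(x) P^{sr}_t(y)⟩)` on the torus of side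
`L` at inverse coupling `β` and bare masses `m_f` (honest lattice QCD expectations `qcdTorusExpect`;
the correlator in the denominator is Lüscher's (7.1)). By the chiral Ward identity at positive
flow time, `⟨{∂_μ A^{rs}_μ(x) - (m_{0,r} + m_{0,s}) P^{rs}(x) + P̃^{rs}(x)} P^{sr}_t(y)⟩ = 0` for all
`x` and `t > 0` ((4.8), tree level; renormalised form (4.14)), this ratio is the bare current-quark
mass average up to the `P̃`-term, which is NOT a contact term (its kernel `K(t, y; 0, x)` decays
like a Gaussian in `|x - y|`, §4.3) and is not removed here. Junk `0` if the denominator vanishes.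
[cite: Luscher2013, (4.8), (7.1) and (8.1)–(8.8)] -/
def flowedPCACMass (β : ℝ) (mq : Fin Nf → ℝ) (t : ℝ) (r s : Fin Nf) (x y : TorusSite 4 L) : ℂ :=
  qcdTorusExpect β L mq (fun V => axialDivergence r s x * flowedPseudoscalarDensity B V t s r y) /
    (2 * qcdTorusExpect β L mq (fun V => pseudoscalarDensity r s x * flowedPseudoscalarDensity B V t s r y))

variable {L}

/-! ### API -/

/-- `QCDOS`'s hermitian pseudo-scalar bilinear `ψ̄_f iγ₅ ψ_g` is the bilinear of the spin matrix
`i γ₅`. [folklore] -/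
theorem pseudoscalarBilinear_eq_quarkBilinear (f g : Fin Nf) (x : TorusSite 4 L) :
    pseudoscalarBilinear f g x = quarkBilinear (Complex.I • gammaFive) f g x := by
  simp [pseudoscalarBilinear, quarkBilinear, Matrix.smul_apply]

variable {B U}

/-- At flow time zero the flowed quark field is the quark field, `χ_0 = ψ` (Lüscher (2.6)), for a
link flow continuous on `[0, ∞)`. [cite: Luscher2013, (2.6)] -/
theorem flowedQuark_zero (hB : ContinuousOn (fun t => B t U) (Ici 0)) (v : QuarkVar Nf L) :
    flowedQuark B U 0 v = q v := by
  obtain ⟨f, x, a, α⟩ := v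
  have h1 : qcdFlowKernel B U 0 = 1 := fermionFlowKernel_zero (continuous_fundamentalRep (Fin 3)) hB
  simp only [flowedQuark, h1]
  rw [Finset.sum_eq_single x, Finset.sum_eq_single a]
  · simp
  · intro b _ hb; simp [Prod.ext_iff, Ne.symm hb]
  · simp
  · intro y _ hy; simp [Prod.ext_iff, Ne.symm hy]
  · simp

/-- At flow time zero the flowed antiquark field is the antiquark field, `χ̄_0 = ψ̄`
(Lüscher (2.6)). [cite: Luscher2013, (2.6)] -/
theorem flowedAntiquark_zero (hB : ContinuousOn (fun t => B t U) (Ici 0)) (v : QuarkVar Nf L) :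
    flowedAntiquark B U 0 v = qbar v := by
  obtain ⟨f, x, a, α⟩ := v
  have h1 : qcdFlowKernel B U 0 = 1 := fermionFlowKernel_zero (continuous_fundamentalRep (Fin 3)) hB
  simp only [flowedAntiquark, h1]
  rw [Finset.sum_eq_single x, Finset.sum_eq_single a]
  · simp
  · intro b _ hb; simp [Prod.ext_iff, Ne.symm hb]
  · simp
  · intro y _ hy; simp [Prod.ext_iff, Ne.symm hy]
  · simp

/-- At flow time zero the flowed bilinears are the unflowed ones (`S^{rs}_0 = ψ̄_r ψ_s`,
`P^{rs}_0 = P^{rs}`). [cite: Luscher2013, (2.6) and (2.8)] -/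
theorem flowedBilinear_zero (hB : ContinuousOn (fun t => B t U) (Ici 0)) (Γ : Matrix (Fin 4) (Fin 4) ℂ)
    (r s : Fin Nf) (x : TorusSite 4 L) :
    flowedBilinear B U 0 Γ r s x = quarkBilinear Γ r s x := by
  simp only [flowedBilinear, quarkBilinear, flowedQuark_zero hB, flowedAntiquark_zero hB]

/-- In particular `P^{rs}_0(x) = P^{rs}(x)`. [cite: Luscher2013, (2.6) and (2.8)] -/
theorem flowedPseudoscalarDensity_zero (hB : ContinuousOn (fun t => B t U) (Ici 0)) (r s : Fin Nf)
    (x : TorusSite 4 L) : flowedPseudoscalarDensity B U 0 r s x = pseudoscalarDensity r s x :=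
  flowedBilinear_zero hB gammaFive r s x

end QCD

end Literature.MathematicalPhysics.QuantumFieldTheory
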